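import Summits.ResolutionOfSingularities.ResolutionOfSingularities.Theorems.WildQuotientsSummitReductionStubPairOrbitNormalFormBlowupModelCharts2
import HarnessLib

/-!
# `WildQuotients.SummitReduction` (stmt-ResolutionOfSingularities-16324), line `FramePerfect`, stub NB1
# (`stub_pair_orbitNormalFormBlowup_modelSingularOverCentre`): the strict transform of
# `z_u z_v - z_a z_b h` on the charts `z_u ≠ 0` and `z_a ≠ 0`

Route `ResolutionOfSingularities/WildQuotients`, crux `SummitReduction`; third helper file of
stub NB1 = de Jong 1996, Claim 4.27 [C1] on the coefficient-free model (de Jong 1997, proof of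
Prop. 5.11). In the set-up of `…OrbitNormalFormBlowupModelCharts.lean` (`R` regular local,
`z : Fin N → R` part of a regular system of parameters, centre `(z ∘ ι)`, `ι : Fin 4 → Fin N`
injective, further branches `S` off the centre, `h = ∏_S z`, the relation
`F = z_{ι0} z_{ι1} - z_{ι2} z_{ι3} h` — the model's `uv - t_a t_b ∏'' tᵢ`), this file PROVES the
chart computation of de Jong 1996, p. 76 ("We get four charts associated to the coordinates
`u, v, t₁, t₂`. By symmetry, we need only deal with two of these"):

* chart `z_{ι0} ≠ 0` (`u ≠ 0`): `algebraMap_F_chartU` — `F = z_u² (e₁ - e₂ e₃ h)` ("equations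
  `v = uv'`, `t₁ = ut₁'`, `t₂ = ut₂'` and `v' - t₁'t₂'t₃ ⋯ t_s = 0`"); `not_dvd_chartU`,
  `ker_mapQuotient_chartU` — the chart of the blow-up of `R/(F)` is `R[I/z_u]/(e₁ - e₂ e₃ h)`;
  **`isRegularLocalRing_chartU`** — it is regular at the primes containing `z_u` ("Clearly, this
  is smooth"): `∂/∂T₁` of the lifted equation is `1`;
* chart `z_{ι2} ≠ 0` (`t₁ ≠ 0`): `algebraMap_F_chartT` — `F = z_a² (e₀ e₁ - e₃ h)` ("equations
  `u = t₁u'`, `v = t₁v'`, `t₂ = t₁t₂'` and `u'v' - t₂' t₃ ⋯ t_s = 0`"); `not_dvd_chartT`,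
  `ker_mapQuotient_chartT`; **`mem_of_mul_strictTransformT_mem_sq`** — at a prime `Q ∋ z_a` with
  `w (e₀ e₁ - e₃ h) ∈ Q²`, `w ∉ Q` (a singular point of the strict transform): `e₀, e₁ ∈ Q`, some
  `z_k ∈ Q` (`k ∈ S`) and `e₃ ∈ Q` or a second `z_{k'} ∈ Q` ("Clearly the singularities are of
  the type described in (ii)") — the Jacobian step for the polynomial variables and, in place of
  `∂/∂t_k`, the estimate `w · z_k ∉ Q²` (`mul_algebraMap_notMem_sq`).

## Sources

* A. J. de Jong, *Smoothness, semi-stability and alterations*, Publ. Math. IHÉS 83 (1996), 4.27,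
  pp. 75–76. [DeJong1996]
* A. J. de Jong, *Families of curves and alterations*, Ann. Inst. Fourier 47 (1997), proof of
  Prop. 5.11, p. 619. [DeJong1997]
* U. Görtz, T. Wedhorn, *Algebraic Geometry I*, 2nd ed. (2020), Prop. 13.96 (2), p. 416.
  [GortzWedhorn2020]
-/

set_option linter.dupNamespace false -- the tree's summit namespace repeats `ResolutionOfSingularities`

noncomputable section

open IsLocalRing

namespace Summit.ResolutionOfSingularities.ResolutionOfSingularities.Theorems

open Literature.AlgebraicGeometry.Resolution

section StrictTransform

variable {R : Type} [CommRing R] [IsLocalRing R] {N : ℕ} {z : Fin N → R} (hz : IsRsopPart z)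
  {ι : Fin 4 → Fin N} (hι : Function.Injective ι) {S : Finset (Fin N)}
  (hS : ∀ k ∈ S, k ∉ Set.range ι) {h : R} (hh : h = ∏ k ∈ S, z k) {F : R}
  (hF : F = z (ι 0) * z (ι 1) - z (ι 2) * z (ι 3) * h)

/-! ## Chart `z_u ≠ 0` (index `0`): the strict transform `e₁ - e₂ e₃ h` is a regular parameter -/

omit [IsLocalRing R] in
/-- The polynomial `T₁ - T₂ T₃ h` lifting the strict transform on the chart `z_u ≠ 0`, and its
value. [cite: DeJong1996, 4.27, p. 76] -/
theorem eval_chartU_poly :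
    blowupAlgebra.eval (z ∘ ι) 0 (MvPolynomial.X ⟨1, by decide⟩ -
        MvPolynomial.X ⟨2, by decide⟩ * MvPolynomial.X ⟨3, by decide⟩ * MvPolynomial.C h) =
      blowupAlgebra.frac (z ∘ ι) 0 1 - blowupAlgebra.frac (z ∘ ι) 0 2 * blowupAlgebra.frac (z ∘ ι) 0 3 *
        algebraMap R _ h := by
  simp only [map_sub, map_mul, blowupAlgebra.eval_X, blowupAlgebra.eval_C]

omit [IsLocalRing R] in
/-- `∂/∂T₁ (T₁ - T₂ T₃ h) = 1`. [folklore] -/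
theorem pderiv_chartU_poly :
    MvPolynomial.pderiv ⟨1, by decide⟩ (MvPolynomial.X ⟨1, by decide⟩ -
        MvPolynomial.X ⟨2, by decide⟩ * MvPolynomial.X ⟨3, by decide⟩ * MvPolynomial.C h :
          MvPolynomial {j : Fin 4 // j ≠ 0} R) = 1 := by
  classical
  simp

include hF in
omit [IsLocalRing R] in
/-- **`F = z_u² · (e₁ - e₂ e₃ h)` on the chart `z_u ≠ 0`** ("equations `v = uv'`, `t₁ = ut₁'`,
`t₂ = ut₂'` and `v' - t₁'t₂'t₃ ⋯ t_s = 0`"). [cite: DeJong1996, 4.27, p. 76] -/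
theorem algebraMap_F_chartU :
    algebraMap R (blowupAlgebra (Ideal.span (Set.range (z ∘ ι))) ((z ∘ ι) 0)) F =
      algebraMap R _ ((z ∘ ι) 0) ^ 2 *
        (blowupAlgebra.frac (z ∘ ι) 0 1 - blowupAlgebra.frac (z ∘ ι) 0 2 * blowupAlgebra.frac (z ∘ ι) 0 3 *
          algebraMap R _ h) := by
  have h1 := blowupAlgebra.algebraMap_mul_gen (Ideal.span (Set.range (z ∘ ι))) ((z ∘ ι) 0) ((z ∘ ι) 1)
    (blowupAlgebra.mem_span_range (z ∘ ι) 1)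
  have h2 := blowupAlgebra.algebraMap_mul_gen (Ideal.span (Set.range (z ∘ ι))) ((z ∘ ι) 0) ((z ∘ ι) 2)
    (blowupAlgebra.mem_span_range (z ∘ ι) 2)
  have h3 := blowupAlgebra.algebraMap_mul_gen (Ideal.span (Set.range (z ∘ ι))) ((z ∘ ι) 0) ((z ∘ ι) 3)
    (blowupAlgebra.mem_span_range (z ∘ ι) 3)
  rw [hF, map_sub, map_mul, map_mul, map_mul]
  change algebraMap R _ ((z ∘ ι) 0) * algebraMap R _ ((z ∘ ι) 1) -
    algebraMap R _ ((z ∘ ι) 2) * algebraMap R _ ((z ∘ ι) 3) * algebraMap R _ h = _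
  rw [← h1, ← h2, ← h3]
  ring

include hz hι in
/-- **`z_u ∤ (e₁ - e₂ e₃ h)`**: the strict transform is not divisible by the exceptional equation
(`∂/∂T₁` of its lift is `1`). [cite: DeJong1996, 4.27, p. 76] -/
theorem not_dvd_chartU :
    ¬ algebraMap R (blowupAlgebra (Ideal.span (Set.range (z ∘ ι))) ((z ∘ ι) 0)) ((z ∘ ι) 0) ∣
      (blowupAlgebra.frac (z ∘ ι) 0 1 - blowupAlgebra.frac (z ∘ ι) 0 2 * blowupAlgebra.frac (z ∘ ι) 0 3 *
        algebraMap R _ h) := by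
  intro hd
  rw [← eval_chartU_poly] at hd
  exact eval_notMem_span_of_pderiv_eq_one (z ∘ ι) 0 (isQuasiRegular_comp_centre hz hι)
    (hz.comp ι hι).span_range_ne_top _ ⟨1, by decide⟩ pderiv_chartU_poly (Ideal.mem_span_singleton.mpr hd)

include hz hι hF in
/-- The kernel of `R[I/z_u] ↠ (R/(F))[Ī/z̄_u]` is generated by the strict transform.
[cite: GortzWedhorn2020, Prop. 13.96 (2) and p. 416] -/
theorem ker_mapQuotient_chartU :
    RingHom.ker (blowupAlgebra.mapQuotient (Ideal.span (Set.range (z ∘ ι))) ((z ∘ ι) 0)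
      (Ideal.span {F})) =
      Ideal.span {blowupAlgebra.frac (z ∘ ι) 0 1 - blowupAlgebra.frac (z ∘ ι) 0 2 *
        blowupAlgebra.frac (z ∘ ι) 0 3 * algebraMap R _ h} :=
  blowupAlgebra.ker_mapQuotient_eq_span _ _ (algebraMap_F_chartU hF) (prime_algebraMap_centre hz hι 0)
    (not_dvd_chartU hz hι)

include hz hι hF in
/-- **Chart `z_u ≠ 0` is regular over the exceptional divisor** ("Clearly, this is smooth"): at a
prime `𝔮 ∋ z̄_u` of `(R/(F))[Ī/z̄_u] ≅ R[I/z_u]/(e₁ - e₂ e₃ h)` the local ring is regular, since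
`R[I/z_u]` is regular and `e₁ - e₂ e₃ h ∉ 𝔪²` (its lift has `∂/∂T₁ = 1`, and the relations of
the chart lie in `I · R[T]`, `I ↦ (z_u) ⊆ 𝔮`). [cite: DeJong1996, 4.27, p. 76] -/
theorem isRegularLocalRing_chartU
    (𝔮 : Ideal (blowupAlgebra ((Ideal.span (Set.range (z ∘ ι))).map (Ideal.Quotient.mk (Ideal.span {F})))
      (Ideal.Quotient.mk (Ideal.span {F}) ((z ∘ ι) 0)))) [𝔮.IsPrime]
    (h0 : algebraMap (R ⧸ Ideal.span {F}) _ (Ideal.Quotient.mk (Ideal.span {F}) ((z ∘ ι) 0)) ∈ 𝔮) :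
    IsRegularLocalRing (Localization.AtPrime 𝔮) := by
  haveI := isRegularRing_chart hz hι 0
  have hQ0 := (algebraMap_mem_comap_mapQuotient_iff (Ideal.span (Set.range (z ∘ ι))) ((z ∘ ι) 0) F 𝔮
    ((z ∘ ι) 0)).mpr h0
  haveI : IsRegularLocalRing (Localization.AtPrime (𝔮.comap (blowupAlgebra.mapQuotient
      (Ideal.span (Set.range (z ∘ ι))) ((z ∘ ι) 0) (Ideal.span {F})))) :=
    IsRegularRing.isRegularLocalRing_localization
      (𝔮.comap (blowupAlgebra.mapQuotient (Ideal.span (Set.range (z ∘ ι))) ((z ∘ ι) 0) (Ideal.span {F})))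
  have hone : (blowupAlgebra.eval (z ∘ ι) 0).toRingHom (MvPolynomial.pderiv ⟨1, by decide⟩
      (MvPolynomial.X ⟨1, by decide⟩ - MvPolynomial.X ⟨2, by decide⟩ * MvPolynomial.X ⟨3, by decide⟩ *
        MvPolynomial.C h)) ∉ 𝔮.comap (blowupAlgebra.mapQuotient
          (Ideal.span (Set.range (z ∘ ι))) ((z ∘ ι) 0) (Ideal.span {F})) := by
    rw [pderiv_chartU_poly, map_one]
    exact (𝔮.comap _).ne_top_iff_one.mp (Ideal.IsPrime.ne_top inferInstance)
  have h2 := notMem_sq_maximalIdeal_of_pderiv_notMem (blowupAlgebra.eval (z ∘ ι) 0).toRingHom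
    (blowupAlgebra.eval_surjective (z ∘ ι) 0) (Ideal.span (Set.range (z ∘ ι)))
    (ker_eval_le_map_C (z ∘ ι) 0 (isQuasiRegular_comp_centre hz hι)) _
    (eval_C_mem_of_mem (z ∘ ι) 0 _ hQ0) ⟨1, by decide⟩ _ hone
  have heval : (blowupAlgebra.eval (z ∘ ι) 0).toRingHom (MvPolynomial.X ⟨1, by decide⟩ -
      MvPolynomial.X ⟨2, by decide⟩ * MvPolynomial.X ⟨3, by decide⟩ * MvPolynomial.C h) =
      blowupAlgebra.frac (z ∘ ι) 0 1 - blowupAlgebra.frac (z ∘ ι) 0 2 * blowupAlgebra.frac (z ∘ ι) 0 3 *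
        algebraMap R _ h := eval_chartU_poly
  rw [heval] at h2
  exact isRegularLocalRing_localization_of_surjective_of_notMem_sq
    (blowupAlgebra.mapQuotient (Ideal.span (Set.range (z ∘ ι))) ((z ∘ ι) 0) (Ideal.span {F}))
    (blowupAlgebra.mapQuotient_surjective _ _ _) _ (ker_mapQuotient_chartU hz hι hF) 𝔮 h2

/-! ## Chart `z_a ≠ 0` (index `2`): the strict transform `e₀ e₁ - e₃ h` -/

omit [IsLocalRing R] in
/-- The value of the polynomial `T₀ T₁ - T₃ h` lifting the strict transform on the chart
`z_a ≠ 0`. [cite: DeJong1996, 4.27, p. 76] -/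
theorem eval_chartT_poly :
    blowupAlgebra.eval (z ∘ ι) 2 (MvPolynomial.X ⟨0, by decide⟩ * MvPolynomial.X ⟨1, by decide⟩ -
        MvPolynomial.X ⟨3, by decide⟩ * MvPolynomial.C h) =
      blowupAlgebra.frac (z ∘ ι) 2 0 * blowupAlgebra.frac (z ∘ ι) 2 1 -
        blowupAlgebra.frac (z ∘ ι) 2 3 * algebraMap R _ h := by
  simp only [map_sub, map_mul, blowupAlgebra.eval_X, blowupAlgebra.eval_C]

omit [IsLocalRing R] in
/-- The partial derivatives of `T₀ T₁ - T₃ h`: `T₁`, `T₀`, `-h`. [folklore] -/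
theorem pderiv_chartT_poly :
    MvPolynomial.pderiv ⟨0, by decide⟩ (MvPolynomial.X ⟨0, by decide⟩ * MvPolynomial.X ⟨1, by decide⟩ -
        MvPolynomial.X ⟨3, by decide⟩ * MvPolynomial.C h : MvPolynomial {j : Fin 4 // j ≠ 2} R) =
      MvPolynomial.X ⟨1, by decide⟩ ∧
    MvPolynomial.pderiv ⟨1, by decide⟩ (MvPolynomial.X ⟨0, by decide⟩ * MvPolynomial.X ⟨1, by decide⟩ -
        MvPolynomial.X ⟨3, by decide⟩ * MvPolynomial.C h : MvPolynomial {j : Fin 4 // j ≠ 2} R) =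
      MvPolynomial.X ⟨0, by decide⟩ ∧
    MvPolynomial.pderiv ⟨3, by decide⟩ (MvPolynomial.X ⟨0, by decide⟩ * MvPolynomial.X ⟨1, by decide⟩ -
        MvPolynomial.X ⟨3, by decide⟩ * MvPolynomial.C h : MvPolynomial {j : Fin 4 // j ≠ 2} R) =
      - MvPolynomial.C h ∧
    MvPolynomial.pderiv ⟨1, by decide⟩ (MvPolynomial.pderiv ⟨0, by decide⟩
      (MvPolynomial.X ⟨0, by decide⟩ * MvPolynomial.X ⟨1, by decide⟩ -
        MvPolynomial.X ⟨3, by decide⟩ * MvPolynomial.C h : MvPolynomial {j : Fin 4 // j ≠ 2} R)) = 1 := by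
  classical
  refine ⟨by simp, by simp, by simp, by simp⟩

include hF in
omit [IsLocalRing R] in
/-- **`F = z_a² · (e₀ e₁ - e₃ h)` on the chart `z_a ≠ 0`** ("equations `u = t₁u'`, `v = t₁v'`,
`t₂ = t₁t₂'` and `u'v' - t₂' t₃ ⋯ t_s = 0`"). [cite: DeJong1996, 4.27, p. 76] -/
theorem algebraMap_F_chartT :
    algebraMap R (blowupAlgebra (Ideal.span (Set.range (z ∘ ι))) ((z ∘ ι) 2)) F =
      algebraMap R _ ((z ∘ ι) 2) ^ 2 *
        (blowupAlgebra.frac (z ∘ ι) 2 0 * blowupAlgebra.frac (z ∘ ι) 2 1 -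
          blowupAlgebra.frac (z ∘ ι) 2 3 * algebraMap R _ h) := by
  have h0 := blowupAlgebra.algebraMap_mul_gen (Ideal.span (Set.range (z ∘ ι))) ((z ∘ ι) 2) ((z ∘ ι) 0)
    (blowupAlgebra.mem_span_range (z ∘ ι) 0)
  have h1 := blowupAlgebra.algebraMap_mul_gen (Ideal.span (Set.range (z ∘ ι))) ((z ∘ ι) 2) ((z ∘ ι) 1)
    (blowupAlgebra.mem_span_range (z ∘ ι) 1)
  have h3 := blowupAlgebra.algebraMap_mul_gen (Ideal.span (Set.range (z ∘ ι))) ((z ∘ ι) 2) ((z ∘ ι) 3)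
    (blowupAlgebra.mem_span_range (z ∘ ι) 3)
  rw [hF, map_sub, map_mul, map_mul, map_mul]
  change algebraMap R _ ((z ∘ ι) 0) * algebraMap R _ ((z ∘ ι) 1) -
    algebraMap R _ ((z ∘ ι) 2) * algebraMap R _ ((z ∘ ι) 3) * algebraMap R _ h = _
  rw [← h0, ← h1, ← h3]
  ring

include hz hι in
/-- **`z_a ∤ (e₀ e₁ - e₃ h)`** (`∂²/∂T₁∂T₀` of its lift is `1`). [cite: DeJong1996, 4.27, p. 76] -/
theorem not_dvd_chartT :
    ¬ algebraMap R (blowupAlgebra (Ideal.span (Set.range (z ∘ ι))) ((z ∘ ι) 2)) ((z ∘ ι) 2) ∣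
      (blowupAlgebra.frac (z ∘ ι) 2 0 * blowupAlgebra.frac (z ∘ ι) 2 1 -
        blowupAlgebra.frac (z ∘ ι) 2 3 * algebraMap R _ h) := by
  intro hd
  rw [← eval_chartT_poly] at hd
  exact eval_notMem_span_of_pderiv_pderiv_eq_one (z ∘ ι) 2 (isQuasiRegular_comp_centre hz hι)
    (hz.comp ι hι).span_range_ne_top _ ⟨0, by decide⟩ ⟨1, by decide⟩ pderiv_chartT_poly.2.2.2
    (Ideal.mem_span_singleton.mpr hd)

include hz hι hF in
/-- The kernel of `R[I/z_a] ↠ (R/(F))[Ī/z̄_a]` is generated by the strict transform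
`e₀ e₁ - e₃ h`. [cite: GortzWedhorn2020, Prop. 13.96 (2) and p. 416] -/
theorem ker_mapQuotient_chartT :
    RingHom.ker (blowupAlgebra.mapQuotient (Ideal.span (Set.range (z ∘ ι))) ((z ∘ ι) 2)
      (Ideal.span {F})) =
      Ideal.span {blowupAlgebra.frac (z ∘ ι) 2 0 * blowupAlgebra.frac (z ∘ ι) 2 1 -
        blowupAlgebra.frac (z ∘ ι) 2 3 * algebraMap R _ h} :=
  blowupAlgebra.ker_mapQuotient_eq_span _ _ (algebraMap_F_chartT hF) (prime_algebraMap_centre hz hι 2)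
    (not_dvd_chartT hz hι)

end StrictTransform

/-! ## The singular primes of the chart `z_a ≠ 0` -/

/-- **The singular primes of the chart `z_a ≠ 0` lie on two further branches** ("Clearly the
singularities are of the type described in (ii)"), coefficient-free: let `Q ∋ z_a` be a prime of
`R[I/z_a]` with `w ∉ Q`, `w · (e₀ e₁ - e₃ h) ∈ Q²`. Then `e₀, e₁ ∈ Q`, some `z_k ∈ Q` (`k ∈ S`),
and either `e₃ ∈ Q` or a second `z_{k'} ∈ Q` (`k ≠ k' ∈ S`). The first three by the Jacobian
step (`∂/∂T₁, ∂/∂T₀, ∂/∂T₃` of the lift are `T₀, T₁, -h`); for the last, if `e₃` and the other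
`z_{k'}` were units at `Q` then `w e₀ e₁ - w (e₀ e₁ - e₃ h) = (w e₃ ∏_{k' ≠ k} z_{k'}) · z_k`
would put `z_k` into `Q⁽²⁾`, contradicting `mul_algebraMap_notMem_sq`.
[cite: DeJong1996, 4.27, p. 76] [cite: DeJong1997, proof of Prop. 5.11, p. 619] -/
theorem mem_of_mul_strictTransformT_mem_sq {R : Type} [CommRing R] [IsLocalRing R] {N : ℕ} {z : Fin N → R}
    (hz : IsRsopPart z) {ι : Fin 4 → Fin N} (hι : Function.Injective ι) {S : Finset (Fin N)}
    (hS : ∀ k ∈ S, k ∉ Set.range ι) {h : R} (hh : h = ∏ k ∈ S, z k)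
    (Q : Ideal (blowupAlgebra (Ideal.span (Set.range (z ∘ ι))) ((z ∘ ι) 2))) [Q.IsPrime]
    (h2 : algebraMap R (blowupAlgebra (Ideal.span (Set.range (z ∘ ι))) ((z ∘ ι) 2)) ((z ∘ ι) 2) ∈ Q)
    {w : blowupAlgebra (Ideal.span (Set.range (z ∘ ι))) ((z ∘ ι) 2)} (hw : w ∉ Q)
    (hwF : w * (blowupAlgebra.frac (z ∘ ι) 2 0 * blowupAlgebra.frac (z ∘ ι) 2 1 -
        blowupAlgebra.frac (z ∘ ι) 2 3 * algebraMap R _ h) ∈ Q ^ 2) :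
    blowupAlgebra.frac (z ∘ ι) 2 0 ∈ Q ∧ blowupAlgebra.frac (z ∘ ι) 2 1 ∈ Q ∧
      ∃ k ∈ S, algebraMap R (blowupAlgebra (Ideal.span (Set.range (z ∘ ι))) ((z ∘ ι) 2)) (z k) ∈ Q ∧
        (blowupAlgebra.frac (z ∘ ι) 2 3 ∈ Q ∨
          ∃ k' ∈ S, k' ≠ k ∧
            algebraMap R (blowupAlgebra (Ideal.span (Set.range (z ∘ ι))) ((z ∘ ι) 2)) (z k') ∈ Q) := by
  -- adapted from `exists_mem_of_not_isRegularLocalRing_nodeDeformationRing_aux` (…ModelSing2.lean)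
  have hq := isQuasiRegular_comp_centre hz hι
  have hd := fun j => eval_pderiv_mem_of_mul_eval_mem_sq (z ∘ ι) 2 hq Q h2 _ hw
    (by rw [eval_chartT_poly]; exact hwF) j
  obtain ⟨hp0, hp1, hp3, -⟩ := pderiv_chartT_poly (R := R) (h := h)
  have hu : blowupAlgebra.frac (z ∘ ι) 2 0 ∈ Q := by
    have := hd ⟨1, by decide⟩
    rwa [hp1, blowupAlgebra.eval_X] at this
  have hv : blowupAlgebra.frac (z ∘ ι) 2 1 ∈ Q := by
    have := hd ⟨0, by decide⟩
    rwa [hp0, blowupAlgebra.eval_X] at this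
  have hhQ : algebraMap R (blowupAlgebra (Ideal.span (Set.range (z ∘ ι))) ((z ∘ ι) 2)) h ∈ Q := by
    have := hd ⟨3, by decide⟩
    rwa [hp3, map_neg, blowupAlgebra.eval_C, neg_mem_iff] at this
  refine ⟨hu, hv, ?_⟩
  -- some `z_k ∈ Q`, `k ∈ S`
  have hprod : ∏ k ∈ S, algebraMap R (blowupAlgebra (Ideal.span (Set.range (z ∘ ι))) ((z ∘ ι) 2)) (z k) ∈ Q := by
    rw [← map_prod, ← hh]
    exact hhQ
  obtain ⟨k, hk, hkQ⟩ := Ideal.IsPrime.prod_mem_iff.mp hprod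
  refine ⟨k, hk, hkQ, ?_⟩
  by_contra hcon
  simp only [not_or, not_exists, not_and] at hcon
  obtain ⟨h3, hother⟩ := hcon
  -- `r = ∏_{k' ≠ k} z_{k'} ∉ Q` and `h = z_k r`
  have hr : algebraMap R (blowupAlgebra (Ideal.span (Set.range (z ∘ ι))) ((z ∘ ι) 2))
      (∏ k' ∈ S.erase k, z k') ∉ Q := by
    intro hmem
    rw [map_prod] at hmem
    obtain ⟨k', hk', hk'Q⟩ := Ideal.IsPrime.prod_mem_iff.mp hmem
    exact hother k' (Finset.mem_of_mem_erase hk') (Finset.ne_of_mem_erase hk') hk'Q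
  have hhe : h = z k * ∏ k' ∈ S.erase k, z k' := by
    rw [hh, Finset.mul_prod_erase _ _ hk]
  have hwr : w * blowupAlgebra.frac (z ∘ ι) 2 3 *
      algebraMap R (blowupAlgebra (Ideal.span (Set.range (z ∘ ι))) ((z ∘ ι) 2)) (∏ k' ∈ S.erase k, z k') ∉ Q := by
    intro hmem
    rcases (‹Q.IsPrime›.mem_or_mem hmem) with hm | hm
    · rcases (‹Q.IsPrime›.mem_or_mem hm) with hm' | hm'
      · exact hw hm'
      · exact h3 hm'
    · exact hr hm
  apply mul_algebraMap_notMem_sq hz hι 2 (hS k hk) Q hkQ hwr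
  have key : w * blowupAlgebra.frac (z ∘ ι) 2 3 *
      algebraMap R (blowupAlgebra (Ideal.span (Set.range (z ∘ ι))) ((z ∘ ι) 2)) (∏ k' ∈ S.erase k, z k') *
        algebraMap R _ (z k) =
      w * (blowupAlgebra.frac (z ∘ ι) 2 0 * blowupAlgebra.frac (z ∘ ι) 2 1) -
        w * (blowupAlgebra.frac (z ∘ ι) 2 0 * blowupAlgebra.frac (z ∘ ι) 2 1 -
          blowupAlgebra.frac (z ∘ ι) 2 3 * algebraMap R _ h) := by
    rw [hhe, map_mul]
    ring
  rw [key]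
  refine Ideal.sub_mem _ (Ideal.mul_mem_left _ _ ?_) hwF
  rw [pow_two]
  exact Ideal.mul_mem_mul hu hv


end Summit.ResolutionOfSingularities.ResolutionOfSingularities.Theorems

end
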